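import Literature.NumberTheory.EllipticCurves.KatzPAdicLFunctionCMField
import HarnessLib

/-!
# Hsieh, *On the non-vanishing of Hecke `L`-values modulo `p`*, Amer. J. Math. 134 (2012)
# 1503–1539 (= arXiv:1208.4751), §6: Theorem A (= Thm. 6.8), Theorem B (= Cor. 6.5) and
# Remark 6.9 (1) — NAMED FACTS, in the vocabulary of the tree's Katz–Hsieh CM frame

Topic `Literature/NumberTheory/EllipticCurves` (namespace = path + paper key `Hsieh2012`).
STATEMENT FILE (D-0064: one file for the §6 results): seven small definitions with bodies
(Hsieh's set `X_𝔩⁻`, the normalised value `L^{alg,𝔩}(0, χν)`, the property (NV), the local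
condition (L), self-duality, the self-dual root number (R), residual self-duality (M3)/(N)), THREE
named facts (`def … : Prop`, cited, nothing asserted; D-0014); statements only, no proofs. No
`sorry`, no `instance`, no notation, no `_holds` (the proofs — Hida's Zariski density of CM points
mod `p`, the toric Eisenstein series of §4 and their Fourier–Whittaker coefficients — are SIZE XL).
Requested by the BSD wall (D-0154 (2) INPUTS, row `bsd-inputs-bed-p1`, `--supports` item 21341):
the crux line `hsieh-lambda` of route `BiquadraticEisensteinDescent` meets this paper as the print
behind Hsieh (J. Amer. Math. Soc. 27 (2014)) Hyp. 7.12 / Prop. 7.16 ("… not residually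
self-dual … [Hsi12, Cor. 6.5]"; the line's audit `HSIEH-AWAY-FROM-P-AUDIT-PART2.md` (U3)). Typing
it makes that citation nameable; it proves nothing about BSD. Everything is stated with the
dictionary of the sibling file `KatzPAdicLFunctionCMField.lean` (Hsieh's Crelle paper
[Hsieh2014mu], same conventions: `KatzCM.IsPAdicCMType`, `KatzCM.InSigma`, `KatzCM.HasKatzType`,
`DeShalit1987.removedEulerFactorsAtZero`, `DeShalit1987.gammaFactorAtZero`, the embedding datum
`ι : ℚ̄_p ≃ ℂ` standing for Hsieh's pair `(ι_∞, ι_p)` with `ι_p = ι⁻¹ ∘ ι_∞`).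

## The printed statements (arXiv:1208.4751v1, `lit read` pagination = arXiv pages)

Setting (p. 1, §1.1 p. 3, §6.1 p. 20). "`F` a totally real field of degree `d` over `ℚ` and `K`
a totally imaginary quadratic extension of `F`. Let `Σ` be a CM type of `K`. … we can attach the CM
period `Ω_∞ = (Ω_{∞,σ})_{σ∈Σ} ∈ (ℂ^×)^Σ` to a Néron differential on an abelian scheme `A/Z̄` of CM
type `(K, Σ)`. Let `p > 2` be a rational prime and let `ℓ ≠ p` be a rational prime and `𝔩` a prime
of `F` above `ℓ`. … an arithmetic Hecke character `χ` of `K^×` with infinity type `kΣ + κ(1 − c)`,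
where `k` is a positive integer and `κ = Σ κ_σ σ` with integers `κ_σ ≥ 0`. … Let `K_{𝔩ⁿ}` be the ray
class field of conductor `𝔩ⁿ` and let `K_{𝔩^∞} = ∪_n K_{𝔩ⁿ}`. Let `K⁻_{𝔩^∞}` be the maximal pro-`ℓ`
anticyclotomic extension of `K` in `K_{𝔩^∞}` and let `Γ⁻ = Gal(K⁻_{𝔩^∞}/K)`. Let `X⁻_𝔩` be the set
of finite order characters of `Γ⁻`. For every `ν ∈ X⁻_𝔩`, we consider
`L^{alg,𝔩}(0, χν) := π^κ Γ_Σ(kΣ + κ) L^{(𝔩)}(0, χν) / Ω_∞^{kΣ+2κ}`, where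
`Γ_Σ(kΣ + κ) = ∏_{σ∈Σ} Γ(k + κ_σ)`. It is known that `L^{alg,𝔩}(0, χν) ∈ Z̄_{(p)}` if `p` is
unramified in `F` and prime to the conductor of `χ`. … `ι_∞ : ℚ̄ ↪ ℂ` and `ι_p : ℚ̄ ↪ ℂ_p` … `𝔪` the
maximal ideal of `Z̄_{(p)}` induced by `ι_p`. (NV) `ι_∞⁻¹(L^{alg,𝔩}(0, χν)) ≢ 0 (mod 𝔪)` for
almost all `ν ∈ X⁻_𝔩`. Here almost all means "except for finitely many `ν ∈ X⁻_𝔩`" if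
`dim_{ℚ_ℓ} F_𝔩 = 1` and "Zariski dense subset of `X⁻_𝔩`" if `dim_{ℚ_ℓ} F_𝔩 > 1`." (p. 2:) "(M3) For
all ideal `𝔞` of `F` prime to `pC`, `χN_{F/ℚ}(𝔞) ≡ τ_{K/F}(𝔞) (mod 𝔪)`. We shall say `χ` is
residually self-dual if the condition (M3) holds for `χ`. … `χ` is self-dual if
`χ|_{𝔸_F^×} = τ_{K/F}|·|_{𝔸_F}`. … Write `C = C⁺IR`, where `C⁺`, `I` and `R` are a product of
split, inert and ramified prime factors over `F` respectively [`C` the conductor of `χ`,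
`C⁻ = IR`]. … For each `v ∣ C⁻`, let `μ_p(χ_v) := inf_{x ∈ K_v^×} v_p(χ(x) − 1)`. … (unr) `p > 2` is
unramified in `F`; (ord) `Σ` is `p`-ordinary." §6.1 (p. 20): "Throughout this section, we retain
the assumptions (unr), (ord) and `(p𝔩, D_{K/F}C) = 1`."

* **Theorem A** (p. 2) = **Theorem 6.8** (p. 23). "Suppose that `𝔩` splits in `K`. Let `χ` be a
  self-dual Hecke character such that (L) `μ_p(χ_v) = 0` for every `v ∣ C⁻`, (R) the global root
  number `W(χ*) = 1`, where `χ* := χ|·|_{𝔸_K}^{−1/2}`, (C) `R` is square-free. Then (NV) holds for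
  `(χ, 𝔩)`." (Thm. A lists the standing hypotheses "(unr), (ord), `(p𝔩, D_{K/F}C) = 1`, `𝔩` splits
  in `K`" explicitly.)
* **Theorem B** (p. 3) = **Corollary 6.5** (p. 22). "Suppose that (unr), (ord) and
  `(p𝔩, D_{K/F}C) = 1`. Suppose further that (L) `μ_p(χ_v) = 0` for every `v ∣ C⁻`, (N) `χ` is not
  residually self-dual. Then (NV) holds for `(χ, 𝔩)`."
* **Remark 6.9** (p. 24). "(1) The assumption (C) has been removed in view of [Hsi12, Prop. 6.3]"
  ([Hsi12] = the Crelle paper [Hsieh2014mu]: Prop. 6.3 = epsilon dichotomy, Remark 6.4 = "Prop.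
  6.3 removes the assumption (C) in [Hsieh:Hecke_CM]"). "(2) … Theorem 6.8 for `χ := χ₁ν` …
  replacing (R) by (Rm): `W(χ*) ≡ 1 (mod 𝔪)`." "(3) … if `μ_p(χ_v) > 0` for some `v ∣ C⁻`, then
  `A_β(χ_v) ≡ 0 (mod 𝔪)` for all `β ∈ F_v^×`, and hence `E^h_χ ≡ 0 (mod 𝔪)` …" "(4) … `𝔩` splits in
  `K` is only used in Prop. 6.7 …".

## Transcription (binder by binder; every notion is the tree's)

* (T1) `K/F`: `K` a CM field (`IsCMField K`), `F = K⁺` (`maximalRealSubfield K`), `c` =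
  `IsCMField.complexConj K` acting on places and ideles; (unr) = `2 < p ∤ D_F`; `Σ` and (ord) are
  carried, as in the sibling Katz file, by a `p`-adic CM type `Σ_p` (`KatzCM.IsPAdicCMType p Σ_p`,
  which forces every prime of `F` above `p` to split in `K`) and `ι` (`Σ = {σ | place(ι⁻¹∘σ) ∈ Σ_p}`);
  "infinity type `kΣ + κ(1 − c)`" = `KatzCM.HasKatzType ι Σ_p χ k κ` (`κ` indexed by the infinite
  places `w ↔ σ_w ∈ Σ`).
* (T2) `𝔩` through a place `𝔏` of `K` above it: the places of `K` above `𝔩` are `{𝔏, c𝔏}`; "`𝔩`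
  splits in `K`" = `c𝔏 ≠ 𝔏`. The typed facts are the FIRST REGIME `dim_{ℚ_ℓ} F_𝔩 = 1` ("except for
  finitely many `ν`"): for split `𝔩`, `e(𝔏|ℓ) = f(𝔏|ℓ) = 1` (`K_𝔏 = F_𝔩 = ℚ_ℓ`; Mathlib
  `Ideal.ramificationIdx/inertiaDeg` over `ℤ`); in Cor. 6.5 (any `𝔩 ∤ D_{K/F}`), `e = f = 1` for the
  prime `𝔏 ∩ 𝒪_F` of `F`. `-- TODO(general form): dim_{ℚ_ℓ} F_𝔩 > 1, where "almost all ν" means a`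
  `-- Zariski-dense subset of Hom(Γ⁻_free, μ_{ℓ^∞}) ⊂ 𝔾_m^d(ℚ̄_ℓ) (Hida, LMS LN 320, §4.2).`
* (T3) `X⁻_𝔩` (`lPowerAnticyclotomicFamily ℓ 𝔏`): a finite-order character of `Gal(K_{𝔩^∞}/K)` is
  a finite-order Hecke character unramified outside `{𝔏, c𝔏}` (`K` has no real place); it factors
  through the maximal ANTICYCLOTOMIC quotient iff `ν ∘ c = ν⁻¹` (reciprocity intertwines `c` on
  `𝕀_K/K^×` with conjugation by a lift of `c`; the dictionary of `IsAnticyclotomicCharacter` in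
  `RohrlichAnticyclotomicNonvanishing.lean`, here at the canonical `c` of a CM field), and through
  the maximal PRO-`ℓ` quotient of that iff its order is a power of `ℓ`.
* (T4) `L^{alg,𝔩}(0, χν)` (`algebraicLValue`): `π^κ = π^{Σ_w κ_w}`, `Γ_Σ(kΣ+κ) = ∏_w Γ(k + κ_w)`,
  `Ω^{kΣ+2κ} = ∏_w Ω_w^{k+2κ_w}`, `L^{(𝔩)}(0, χν) = ∏_{w ∈ {𝔏,c𝔏}}(1 − \widetilde{χν}(w)) · L(0, χν)`
  — the Euler factors above `𝔩` removed from the PRIMITIVE `L`-function of `χν` (the tree's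
  `heckeLFunction (χ * ν)`; `removedEulerFactorsAtZero` is value-extended-by-zero, so nothing is
  removed where `χν` is ramified), the value at `0` being that of an entire continuation supplied as
  a binder `hL : LFunction.HasEntireContinuation` (for type `kΣ + κ(1−c)`, `k ≥ 1`,
  `|χν(ϖ_w)| = Nw^{−k/2}`: genuine Euler product on `re s > 1`, unique continuation; its
  EXISTENCE — Hecke — is not asserted).
* (T5) (NV) AND THE PERIOD — THE ONE DEVIATION FROM PRINT. The tree has no CM abelian scheme, hence
  no CM period `Ω_∞` and no name for the class `Ω_∞·(Z̄_{(p)}^×)^Σ` on which "`≢ 0 mod 𝔪`" is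
  defined. Print gives (with the integrality sentence of p. 1 = Hida, LMS LN 320, Thm. 4.3): for
  `Ω = Ω_∞` ALL `ι_p(L^{alg,𝔩}(0, χν))`, `ν ∈ X⁻_𝔩`, lie in `Z̄_p`, and all but finitely many are
  units. `NV ι ℓ 𝔏 χ k κ` types exactly this with `Ω` EXISTENTIAL (`x ∈ 𝔪 ⟺ ‖ι_p x‖ < 1`). Implied
  by print (`Ω := Ω_∞`); its period-free content: the `p`-adic valuations of
  `ι⁻¹(π^κΓ_Σ L^{(𝔩)}(0,χν))` are bounded below and attain their minimum at all but finitely many `ν`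
  (changing `Ω` rescales every value by one constant). WEAKER than print, which also says that the
  minimum is `v_p(Ω_∞^{kΣ+2κ})`. `-- TODO(general form): (NV) at the CM period Ω_∞ of (K, Σ), once`
  `-- CM periods of abelian schemes of type (K, Σ) exist in the tree.`
* (T6) (L) `μ_p(χ_v) = 0` at a non-split `w` (`HasLocalMuZero`): "every `v_p(ι⁻¹(χ_w(x) − 1)) ≥ 0`
  and some `= 0`" (the infimum is attained, see the docstring); `v ∣ C⁻` = `cw = w`, `χ` ramified.
* (T7) self-dual (`IsSelfDual`): `χ·(χ∘c) = ‖·‖_{𝔸_K}` (`normCharacter`). Print's `χ|_{𝔸_F^×} =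
  τ_{K/F}|·|_{𝔸_F}` implies it (`χ(x)χ(x^c) = χ(Nx) = τ(Nx)|Nx|_F = |x|_K`); conversely it gives
  `χ|_{𝔸_F^×}|·|_F⁻¹ ∈ {1, τ_{K/F}}` (characters of `𝔸_F^×/F^×N(𝔸_K^×) = Gal(K/F)`), and `1` is
  impossible for infinity type `kΣ+κ(1−c)` (at a real place `x ↦ x^k` is not `|x|`); both force
  `k = 1`, and the self-dual facts are typed at `k = 1`.
* (T8) (R) (`IsSelfDualRootNumber κ χ 1`): for self-dual `χ` of type `Σ + κ(1−c)`, `χ* = χ|·|^{−1/2}`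
  is unitary, `χ*_w(z) = (z/|z|)^{±(1+2κ_w)}`, `\overline{χ*} = χ*∘c`, `L(s, χ*∘c) = L(s, χ*) =
  L(s − ½, χ)`; Hecke–Tate reads `Λ(s) = W(χ*)Λ(1 − s)`, `Λ(s) = B^s ∏_w Γ_ℂ(s + κ_w + ½) L(s − ½, χ)`,
  `B = (|d_K|N𝔣)^{1/2}`, `W(χ*) = ∏_v W(χ*_v) = ±1`. Typed with `B > 0` and the entire `Λ`
  EXISTENTIAL (no conductor ideal in the tree); `W` stays pinned: two solutions give
  `(B′/B)^{2s−1} = W′/W` on the non-vanishing locus of `Λ`, so `B′ = B`, `W′ = W`.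
* (T9) (M3) (`IsResiduallySelfDual`), prime by prime as printed (ideal-theoretic): for `v ∤ pCD_{K/F}`
  a prime of `F`, `χ(v𝒪_K)N(v) ≡ τ_{K/F}(v) (mod 𝔪)`; split `v = w·cw`: `χ(ϖ_w)χ(ϖ_{cw})Nw ≡ 1`;
  inert `v` below `w`: `χ_w(ϖ_v)q ≡ −1`, `q² = Nw` (`valueAtUniformizer`). §6.2's avatar form
  `χ̂⁺ ≡ τ_{K/F}ω_F` is equivalent (Chebotarev). (N) = its negation. (C) = `a(χ_w) ≤ 1` at every `w`
  ramified in `K/F` (`conductorExponentAt`). `(p𝔩, D_{K/F}C) = 1` = `χ` unramified above `p` and at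
  `𝔏, c𝔏` (`K/F` is unramified above `p` by (ord) and above a split `𝔩`; in Cor. 6.5 "`𝔩 ∤ D_{K/F}`"
  is the binder `e(𝔏|F) = 1`).

## What is NOT typed (deliberately)

The second regime of "almost all" ((T2)); the CM period as an object ((T5)); Rem. 6.9 (2) ((Rm)
needs root numbers of non-self-dual `χ`), (3) (the partial Gauss sums `A_β(χ_v)` (4.14)/(4.17) and
the Eisenstein series `E^h_χ` are not tree objects), (4) (commentary); the intro's Theorem (Hida)
and the internal Prop. 6.3, Lemma 6.4, Lemma 6.6, Prop. 6.7; the necessity of (L), (R) (p. 2,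
attributions). No bridge to `KatzCM.IsMeasure`. `lPowerAnticyclotomicFamily 0 𝔏` is junk.

## References

* [Hsieh2012] M.-L. Hsieh, Amer. J. Math. 134 (2012) 1503–1539 = arXiv:1208.4751: pp. 1–3
  (setting, (NV), (M3), self-dual, `μ_p`, Thms. A, B), §4.1 p. 10 (`χ*`), §6 pp. 20–24.
* [Hsieh2014mu] M.-L. Hsieh, J. reine angew. Math. 688 (2014) = arXiv:1112.1574, §1, Prop. 6.3,
  Remark 6.4. H. Hida, LMS LN 320 (2007) 207–269, §4.2 (the two regimes), Thm. 4.3 (integrality).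
* Tree: `KatzPAdicLFunctionCMField.lean` ((T1)); `RohrlichAnticyclotomicNonvanishing.lean` ((T3), (T8)).
-/

noncomputable section

open scoped Classical
open NumberField IsDedekindDomain
open Literature.NumberTheory.GaloisRepresentations

namespace Literature.NumberTheory.EllipticCurves.Hsieh2012

/-! ### §1. Vocabulary -/

section Vocabulary

variable {K : Type} [Field K] [NumberField K] [IsCMField K] {p : ℕ} [Fact p.Prime]

/-- **Hsieh's `X⁻_𝔩`** — "the set of finite order characters of `Γ⁻ = Gal(K⁻_{𝔩^∞}/K)`", `K⁻_{𝔩^∞}`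
the maximal pro-`ℓ` anticyclotomic extension of `K` inside `K_{𝔩^∞} = ∪_n K_{𝔩ⁿ}` (p. 1) — as a
set of Hecke characters of the CM field `K` (module docstring (T3)): `ν` of `ℓ`-power order
(`ν^{ℓⁿ} = 1`), anticyclotomic (`ν ∘ c = ν⁻¹`, `c` = complex conjugation acting on ideles,
`HeckeCharacter.galConj`), and unramified at every finite place other than the places `𝔏`, `c𝔏`
above `𝔩` (`𝔏` a place of `K` above `𝔩`; `ℓ` is meant to be its residue characteristic, a prime;
for `ℓ = 0` the first clause is junk). [cite: Hsieh2012, p. 1 (Introduction: `K_{𝔩ⁿ}`, `K⁻_{𝔩^∞}`, `Γ⁻`, `X⁻_𝔩`)] -/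
def lPowerAnticyclotomicFamily (ℓ : ℕ) (𝔏 : HeightOneSpectrum (𝓞 K)) : Set (HeckeCharacter K) :=
  {ν | (∃ n : ℕ, ν ^ ℓ ^ n = 1) ∧
    HeckeCharacter.galConj (IsCMField.complexConj K) ν = ν⁻¹ ∧
    ∀ w : HeightOneSpectrum (𝓞 K), w ≠ 𝔏 → w ≠ IsCMField.complexConj K • 𝔏 → ν.IsUnramifiedAt w}

/-- **`L^{alg,𝔩}(0, ψ; Ω) := π^κ Γ_Σ(kΣ + κ) L^{(𝔩)}(0, ψ) / Ω^{kΣ+2κ}`** (p. 1), for a character `ψ`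
(meant: `χν`) of infinity type `kΣ + κ(1 − c)`, a period vector `Ω = (Ω_w)_w` indexed by the
infinite places (`w ↔ σ_w ∈ Σ`), and the value `Lval = L(0, ψ)` of (a continuation of) the primitive
`L`-function of `ψ` supplied by the caller (module docstring (T4)):
`π^{Σ_w κ_w} · ∏_w Γ(k + κ_w) · (∏_w Ω_w^{k+2κ_w})⁻¹ · ∏_{w ∈ {𝔏, c𝔏}} (1 − ψ̃(w)) · Lval`
(`DeShalit1987.gammaFactorAtZero`, `DeShalit1987.removedEulerFactorsAtZero`; for non-split `𝔏` the
finset `{𝔏, c𝔏}` is `{𝔏}`). [cite: Hsieh2012, p. 1 (Introduction, definition of `L^{alg,𝔩}(0, χν)` and `Γ_Σ`)] -/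
def algebraicLValue (k : ℕ) (κ : InfinitePlace K → ℕ) (Ω : InfinitePlace K → ℂ)
    (𝔏 : HeightOneSpectrum (𝓞 K)) (ψ : HeckeCharacter K) (Lval : ℂ) : ℂ :=
  (Real.pi : ℂ) ^ (∑ w, κ w) * (∏ w, DeShalit1987.gammaFactorAtZero (k + κ w)) *
    (∏ w, Ω w ^ (k + 2 * κ w))⁻¹ *
    (DeShalit1987.removedEulerFactorsAtZero ψ {𝔏, IsCMField.complexConj K • 𝔏} * Lval)

/-- **(NV) for `(χ, 𝔩)`** in the regime `dim_{ℚ_ℓ} F_𝔩 = 1` — "`ι_∞⁻¹(L^{alg,𝔩}(0, χν)) ≢ 0 (mod 𝔪)`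
for all but finitely many `ν ∈ X⁻_𝔩`" (p. 1), `𝔪` induced by `ι_p` — typed with the CM period
EXISTENTIAL and the known integrality built in (module docstring (T5), the one deviation from
print): there is `Ω = (Ω_w)_w`, `Ω_w ≠ 0`, such that for every `ν ∈ X⁻_𝔩` and every entire
continuation `hL` of `L(s, χν)` the value `L^{alg,𝔩}(0, χν; Ω)` satisfies `‖ι⁻¹(·)‖ ≤ 1`
(`∈ Z̄_p`), and the set of `ν ∈ X⁻_𝔩` admitting a continuation value with `‖ι⁻¹(·)‖ < 1` (`∈ 𝔪`) is
finite. For `Ω = Ω_∞` the CM period of `(K, Σ)` this is the printed (NV) together with "It is known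
that `L^{alg,𝔩}(0, χν) ∈ Z̄_{(p)}`" (p. 1); with `Ω` existential it is implied by print and records
that the `p`-adic valuations of the values are bounded below with the minimum attained at all but
finitely many `ν`. Parameters `k, κ`: the infinity type `kΣ + κ(1−c)` of `χ` (a finite-order `ν` has
trivial infinity type). [cite: Hsieh2012, p. 1 (Introduction, (NV) and "almost all … except for finitely many ν ∈ X⁻_𝔩 if dim_{ℚ_ℓ} F_𝔩 = 1"; integrality sentence)] -/
def NV (ι : PadicAlgCl p ≃+* ℂ) (ℓ : ℕ) (𝔏 : HeightOneSpectrum (𝓞 K)) (χ : HeckeCharacter K)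
    (k : ℕ) (κ : InfinitePlace K → ℕ) : Prop :=
  ∃ Ω : InfinitePlace K → ℂ, (∀ w, Ω w ≠ 0) ∧
    (∀ ν ∈ lPowerAnticyclotomicFamily ℓ 𝔏,
      ∀ hL : LFunction.HasEntireContinuation (heckeLFunction (χ * ν)),
        ‖ι.symm (algebraicLValue k κ Ω 𝔏 (χ * ν) (hL.continuation 0))‖ ≤ 1) ∧
    {ν : HeckeCharacter K | ν ∈ lPowerAnticyclotomicFamily ℓ 𝔏 ∧
      ∃ hL : LFunction.HasEntireContinuation (heckeLFunction (χ * ν)),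
        ‖ι.symm (algebraicLValue k κ Ω 𝔏 (χ * ν) (hL.continuation 0))‖ < 1}.Finite

/-- **(L) at one place: `μ_p(χ_w) = 0`**, where "`μ_p(χ_v) := inf_{x ∈ K_v^×} v_p(χ(x) − 1)`" (p. 2;
[Hsieh2014mu] §1), `v_p` induced by `ι_p = ι⁻¹`, `χ_w` the local component
(`HeckeCharacter.localComponent`): every `v_p(ι⁻¹(χ_w(x) − 1)) ≥ 0` (`‖·‖ ≤ 1`) and some
`v_p(ι⁻¹(χ_w(x) − 1)) = 0` (`‖·‖ = 1`). The infimum IS attained when it is `0` and the values are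
integral (`χ_w(K_w^×) = αᶻ·μ_N` with `α = χ_w(ϖ)`: if every `αⁿζ ≡ 1 (mod 𝔪)` then
`v_p(αⁿζ − 1) ≥ min(v_p(α − 1), v_p(ζ − 1)) > 0` uniformly), so this is `μ_p(χ_w) = 0` verbatim;
proof of Lemma 6.4 (p. 22): "the assumption `μ_p(χ_v) = 0` is equivalent to `χ|_{E^×} ≢ 1 (mod 𝔪)`".
Meant for `w` non-split over `F` (`K_v = K_w`). [cite: Hsieh2012, p. 2 (Introduction, `μ_p(χ_v)` and hypothesis (L)) and Lemma 6.4 (p. 22)] -/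
def HasLocalMuZero (ι : PadicAlgCl p ≃+* ℂ) (χ : HeckeCharacter K) (w : HeightOneSpectrum (𝓞 K)) :
    Prop :=
  (∀ x : (w.adicCompletion K)ˣ, ‖ι.symm (((χ.localComponent w x : ℂˣ) : ℂ) - 1)‖ ≤ 1) ∧
    ∃ x : (w.adicCompletion K)ˣ, ‖ι.symm (((χ.localComponent w x : ℂˣ) : ℂ) - 1)‖ = 1

/-- **`χ` is self-dual** — "`χ|_{𝔸_F^×} = τ_{K/F}|·|_{𝔸_F}`" (p. 2; [Hsieh2014mu] §1) — typed on `𝕀_K`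
as `χ · (χ ∘ c) = ‖·‖_{𝔸_K}` (`HeckeCharacter.galConj` at `c = IsCMField.complexConj K`,
`HeckeCharacter.normCharacter`): implied by print (`χ(x)χ(x^c) = χ(N_{K/F}x) = |x|_{𝔸_K}`) and
equivalent to it for characters of infinity type `kΣ + κ(1 − c)` (module docstring (T7)); either
form forces `k = 1`. (For `K` imaginary quadratic and `φ := χ⁻¹`, of weight-one type, this is
`IsHeckeConjEquivariant c φ`, `φ ∘ c = \overline{φ}`, of `RohrlichAnticyclotomicNonvanishing.lean`.)
A predicate on `χ`, not a fact. [cite: Hsieh2012, p. 2 (Introduction, "χ is self-dual if χ|_{𝔸_F^×} = τ_{K/F}|·|_{𝔸_F}")] -/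
def IsSelfDual (χ : HeckeCharacter K) : Prop :=
  χ * HeckeCharacter.galConj (IsCMField.complexConj K) χ = HeckeCharacter.normCharacter K

/-- **`W` is the global root number `W(χ*)` of the self-dual character `χ`**, `χ* := χ|·|_{𝔸_K}^{−1/2}`
(§4.1 p. 10; hypothesis (R) of Thm. A is `W(χ*) = 1`), for `χ` of infinity type `Σ + κ(1 − c)`
(module docstring (T8)): there are `B > 0` and an entire `Λ` with
`Λ(s) = B^s · ∏_w Γ_ℂ(s + κ_w + ½) · L(s − ½, χ)` for `re s > 1` (`L(s, χ*) = L(s − ½, χ)`, genuine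
Euler product there; `Γ_ℂ(s) = 2(2π)^{−s}Γ(s)`, Mathlib `Complex.Gammaℂ`, the archimedean factor of
`χ*_w(z) = (z/|z|)^{±(1+2κ_w)}`) and `Λ(s) = W · Λ(1 − s)` for all `s` — the self-dual form of the
Hecke–Tate functional equation `Λ(s, χ*) = W(χ*)Λ(1 − s, \overline{χ*})`, `\overline{χ*} = χ* ∘ c`
having the same `L`- and `Γ`-factors; `B` (in print `(|d_K|N𝔣(χ*))^{1/2}`) existential, which still
pins `W` ((T8)). A predicate; the existence of `(B, Λ, W)` with `W = ±1` is Hecke–Tate (Lemma 6.6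
cites [MS00] for the local signs) and is not asserted. [cite: Hsieh2012, Theorem A (p. 2) hypothesis (R), §4.1 (p. 10, `χ*`), Lemma 6.6 (p. 22)] -/
def IsSelfDualRootNumber (κ : InfinitePlace K → ℕ) (χ : HeckeCharacter K) (W : ℂ) : Prop :=
  ∃ B : ℝ, 0 < B ∧ ∃ Λ : ℂ → ℂ, Differentiable ℂ Λ ∧
    (∀ s : ℂ, 1 < s.re →
      Λ s = (B : ℂ) ^ s * (∏ w, Complex.Gammaℂ (s + (κ w : ℂ) + 1 / 2)) *
        heckeLFunction χ (s - 1 / 2)) ∧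
    ∀ s : ℂ, Λ s = W * Λ (1 - s)

/-- **`χ` is residually self-dual** — condition (M3) (p. 2): "for all ideal `𝔞` of `F` prime to `pC`,
`χN_{F/ℚ}(𝔞) ≡ τ_{K/F}(𝔞) (mod 𝔪)`" — prime by prime over the primes `v ∤ p C D_{K/F}` of `F`, read
through the places `w` of `K` above `v` (module docstring (T9)): if `w ∤ p`, `χ` is unramified at
`w` and `cw`, and `w` is unramified over `F` (`e(w|F) = 1`), then for `v` SPLIT (`cw ≠ w`,
`v𝒪_K = w·cw`, `Nv = Nw`, `τ = 1`) `‖ι⁻¹(χ(ϖ_w)χ(ϖ_{cw})Nw − 1)‖ < 1`, and for `v` INERT (`cw = w`,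
`v𝒪_K = w`, `Nw = Nv²`, `τ = −1`) `‖ι⁻¹(χ(ϖ_w)q + 1)‖ < 1` for the `q` with `q² = Nw`
(`HeckeCharacter.valueAtUniformizer`, `HeightOneSpectrum.residueCard`). §6.2 (p. 21) writes the
same condition on avatars, `χ̂⁺ ≡ τ_{K/F}ω_F (mod 𝔪)`. Hypothesis (N) of Cor. 6.5 is `¬` this.
[cite: Hsieh2012, p. 2 (Introduction, (M3) "residually self-dual") and §6.2 (p. 21)] -/
def IsResiduallySelfDual (ι : PadicAlgCl p ≃+* ℂ) (χ : HeckeCharacter K) : Prop :=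
  ∀ w : HeightOneSpectrum (𝓞 K), ((p : ℕ) : 𝓞 K) ∉ w.asIdeal →
    χ.IsUnramifiedAt w → χ.IsUnramifiedAt (IsCMField.complexConj K • w) →
    w.asIdeal.ramificationIdx (𝓞 (maximalRealSubfield K)) = 1 →
    (IsCMField.complexConj K • w ≠ w →
      ‖ι.symm (χ.valueAtUniformizer w * χ.valueAtUniformizer (IsCMField.complexConj K • w) *
          (w.residueCard : ℂ) - 1)‖ < 1) ∧
    (IsCMField.complexConj K • w = w → ∀ q : ℕ, q * q = w.residueCard →
      ‖ι.symm (χ.valueAtUniformizer w * (q : ℂ) + 1)‖ < 1)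

end Vocabulary

/-! ### §2. The named facts -/

section Facts

/-- **Hsieh 2012, Theorem B (p. 3) = Corollary 6.5 (p. 22) — (NV) for a character that is NOT
residually self-dual**, in the regime `dim_{ℚ_ℓ} F_𝔩 = 1`. Verbatim: "Suppose that (unr), (ord) and
`(p𝔩, D_{K/F}C) = 1`. Suppose further that the following conditions hold: (L) `μ_p(χ_v) = 0` for
every `v ∣ C⁻`, (N) `χ` is not residually self-dual. Then (NV) holds for `(χ, 𝔩)`." Binders (module
docstring (T1)–(T6), (T9)): `2 < p ∤ D_F`; `K` CM; `Σ_p` a `p`-adic CM type ((ord)); `ℓ ≠ p`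
prime, `𝔏 ∣ ℓ` a place of `K` with `e(𝔏|F) = 1` (`𝔩 ∤ D_{K/F}`) and `e = f = 1` for the prime
`𝔩 = 𝔏 ∩ 𝒪_F` over `ℤ` (`F_𝔩 = ℚ_ℓ`, first regime); `χ` of infinity type `kΣ + κ(1−c)`, `k ≥ 1`,
unramified above `p` and at `𝔏`, `c𝔏` (`(p𝔩, C) = 1`); (L) at every non-split ramified place; (N).
Conclusion `NV ι ℓ 𝔏 χ k κ` ((T5): period existential — WEAKER than print).
`-- TODO(general form): dim_{ℚ_ℓ} F_𝔩 > 1 (Zariski density); (NV) at the CM period Ω_∞.`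
[cite: Hsieh2012, Theorem B (p. 3) = Corollary 6.5 (p. 22), with §6.1 (p. 20) and pp. 1–2 (setting, (NV), (L), (M3))] -/
def cor65_NV_of_not_isResiduallySelfDual : Prop :=
  ∀ (p : ℕ) [Fact p.Prime], 2 < p →
  ∀ (K : Type) [Field K] [NumberField K] [IsCMField K],
    ¬ (p : ℤ) ∣ NumberField.discr (maximalRealSubfield K) →
  ∀ (ι : PadicAlgCl p ≃+* ℂ) (Sp : Finset (HeightOneSpectrum (𝓞 K))), KatzCM.IsPAdicCMType p Sp →
  ∀ (ℓ : ℕ) (𝔏 : HeightOneSpectrum (𝓞 K)), ℓ.Prime → ℓ ≠ p → ((ℓ : ℕ) : 𝓞 K) ∈ 𝔏.asIdeal →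
    𝔏.asIdeal.ramificationIdx (𝓞 (maximalRealSubfield K)) = 1 →
    (𝔏.asIdeal.under (𝓞 (maximalRealSubfield K))).ramificationIdx ℤ = 1 →
    (𝔏.asIdeal.under (𝓞 (maximalRealSubfield K))).inertiaDeg ℤ = 1 →
  ∀ (χ : HeckeCharacter K) (k : ℕ) (κ : InfinitePlace K → ℕ), 1 ≤ k →
    KatzCM.HasKatzType ι Sp χ k κ →
    (∀ w : HeightOneSpectrum (𝓞 K), ((p : ℕ) : 𝓞 K) ∈ w.asIdeal → χ.IsUnramifiedAt w) →
    χ.IsUnramifiedAt 𝔏 → χ.IsUnramifiedAt (IsCMField.complexConj K • 𝔏) →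
    (∀ w : HeightOneSpectrum (𝓞 K), IsCMField.complexConj K • w = w → ¬ χ.IsUnramifiedAt w →
      HasLocalMuZero ι χ w) →
    ¬ IsResiduallySelfDual ι χ →
    NV ι ℓ 𝔏 χ k κ

/-- **Hsieh 2012, Theorem A (p. 2) = Theorem 6.8 (p. 23) — (NV) for a SELF-DUAL character under
(L), (R), (C)**, in the regime `dim_{ℚ_ℓ} F_𝔩 = 1`. Verbatim (Thm. 6.8): "Suppose that `𝔩` splits in
`K`. Let `χ` be a self-dual Hecke character such that (L) `μ_p(χ_v) = 0` for every `v ∣ C⁻`, (R) The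
global root number `W(χ*) = 1`, (C) `R` is square-free. Then (NV) holds for `(χ, 𝔩)`"; Thm. A adds
the standing "(unr), (ord), `(p𝔩, D_{K/F}C) = 1`, `𝔩` splits in `K`". Binders (module docstring
(T1)–(T9)): `2 < p ∤ D_F`; `K` CM; `Σ_p` a `p`-adic CM type; `ℓ ≠ p` prime, `𝔏 ∣ ℓ` with `c𝔏 ≠ 𝔏`
(`𝔩` splits) and `e(𝔏|ℓ) = f(𝔏|ℓ) = 1` (`F_𝔩 = K_𝔏 = ℚ_ℓ`, first regime); `χ` of infinity type
`Σ + κ(1−c)` (`k = 1`, forced by self-duality, (T7)), self-dual, unramified above `p` and at `𝔏`,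
`c𝔏`; (L) at every non-split ramified place; (R) `IsSelfDualRootNumber κ χ 1`; (C) conductor
exponent `≤ 1` at every place ramified in `K/F`. Conclusion `NV ι ℓ 𝔏 χ 1 κ` ((T5): period
existential — WEAKER than print). `-- TODO(general form): dim_{ℚ_ℓ} F_𝔩 > 1; (NV) at Ω_∞.`
[cite: Hsieh2012, Theorem A (p. 2) = Theorem 6.8 (p. 23), with §6.1 (p. 20) and pp. 1–2 (setting, (NV), (L), (R), (C))] -/
def thmA_NV_of_isSelfDual : Prop :=
  ∀ (p : ℕ) [Fact p.Prime], 2 < p →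
  ∀ (K : Type) [Field K] [NumberField K] [IsCMField K],
    ¬ (p : ℤ) ∣ NumberField.discr (maximalRealSubfield K) →
  ∀ (ι : PadicAlgCl p ≃+* ℂ) (Sp : Finset (HeightOneSpectrum (𝓞 K))), KatzCM.IsPAdicCMType p Sp →
  ∀ (ℓ : ℕ) (𝔏 : HeightOneSpectrum (𝓞 K)), ℓ.Prime → ℓ ≠ p → ((ℓ : ℕ) : 𝓞 K) ∈ 𝔏.asIdeal →
    IsCMField.complexConj K • 𝔏 ≠ 𝔏 →
    𝔏.asIdeal.ramificationIdx ℤ = 1 → 𝔏.asIdeal.inertiaDeg ℤ = 1 →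
  ∀ (χ : HeckeCharacter K) (κ : InfinitePlace K → ℕ),
    KatzCM.HasKatzType ι Sp χ 1 κ → IsSelfDual χ →
    (∀ w : HeightOneSpectrum (𝓞 K), ((p : ℕ) : 𝓞 K) ∈ w.asIdeal → χ.IsUnramifiedAt w) →
    χ.IsUnramifiedAt 𝔏 → χ.IsUnramifiedAt (IsCMField.complexConj K • 𝔏) →
    (∀ w : HeightOneSpectrum (𝓞 K), IsCMField.complexConj K • w = w → ¬ χ.IsUnramifiedAt w →
      HasLocalMuZero ι χ w) →
    IsSelfDualRootNumber κ χ 1 →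
    (∀ w : HeightOneSpectrum (𝓞 K), w.asIdeal.ramificationIdx (𝓞 (maximalRealSubfield K)) ≠ 1 →
      χ.conductorExponentAt w ≤ 1) →
    NV ι ℓ 𝔏 χ 1 κ

/-- **Hsieh 2012, Remark 6.9 (1) (p. 24) with [Hsieh2014mu] Prop. 6.3 / Remark 6.4 — Theorem 6.8
WITHOUT the hypothesis (C)**: "The assumption (C) has been removed in view of [Hsi12, Prop. 6.3]"
(AJM), "In virtue of [Hsieh:Hecke_CM], Prop. 6.3 removes the assumption (C) in [Hsieh:Hecke_CM]"
(Crelle: Prop. 6.3 = the epsilon dichotomy `W(χ*_v)τ(β_v) = χ*_v(2ϑ)` for some `β_v` with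
`v_p(A_{β_v}(χ_v)) = μ_p(χ_v)`, replacing the only use of (C) in the proof of Thm. 6.8 via Prop.
6.7). Same binders as `thmA_NV_of_isSelfDual` minus (C); same regime and deviation
(`-- TODO(general form): dim_{ℚ_ℓ} F_𝔩 > 1; (NV) at Ω_∞`). A published remark resting on a published
proposition of the same author; recorded as its own named fact so that consumers may choose.
[cite: Hsieh2012, Remark 6.9 (1) (p. 24) with Theorem 6.8 (p. 23)]
[cite: Hsieh2014mu, Prop. 6.3 and Remark 6.4 (§6.1)] -/
def rem69_NV_of_isSelfDual : Prop :=
  ∀ (p : ℕ) [Fact p.Prime], 2 < p →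
  ∀ (K : Type) [Field K] [NumberField K] [IsCMField K],
    ¬ (p : ℤ) ∣ NumberField.discr (maximalRealSubfield K) →
  ∀ (ι : PadicAlgCl p ≃+* ℂ) (Sp : Finset (HeightOneSpectrum (𝓞 K))), KatzCM.IsPAdicCMType p Sp →
  ∀ (ℓ : ℕ) (𝔏 : HeightOneSpectrum (𝓞 K)), ℓ.Prime → ℓ ≠ p → ((ℓ : ℕ) : 𝓞 K) ∈ 𝔏.asIdeal →
    IsCMField.complexConj K • 𝔏 ≠ 𝔏 →
    𝔏.asIdeal.ramificationIdx ℤ = 1 → 𝔏.asIdeal.inertiaDeg ℤ = 1 →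
  ∀ (χ : HeckeCharacter K) (κ : InfinitePlace K → ℕ),
    KatzCM.HasKatzType ι Sp χ 1 κ → IsSelfDual χ →
    (∀ w : HeightOneSpectrum (𝓞 K), ((p : ℕ) : 𝓞 K) ∈ w.asIdeal → χ.IsUnramifiedAt w) →
    χ.IsUnramifiedAt 𝔏 → χ.IsUnramifiedAt (IsCMField.complexConj K • 𝔏) →
    (∀ w : HeightOneSpectrum (𝓞 K), IsCMField.complexConj K • w = w → ¬ χ.IsUnramifiedAt w →
      HasLocalMuZero ι χ w) →
    IsSelfDualRootNumber κ χ 1 →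
    NV ι ℓ 𝔏 χ 1 κ

end Facts

end Literature.NumberTheory.EllipticCurves.Hsieh2012

end
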